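import Summits.SmoothPoincare4.SmoothPoincare4.Theorems.SymplecticOrigamiGromovRecognitionRelEndStubReadSigmaAux2
import Literature.Geometry.Manifold.InverseFunctionTheorem

/-!
# Reading the bi-foliation chart `σ` — `σ` is a bijection, its differential, `σ` is a diffeomorphism
(stub `stub_readSigma` of line `cross-cap-laurent`, crux `SymplecticOrigami.GromovRecognitionRelEnd`,
item stmt-SmoothPoincare4-11009; third auxiliary file)

* `σf` is injective (joint injectivity of the labels, `ι` injective) and surjective (joint
  surjectivity of the affine labels; the preimage is off `V∞ ∪ H∞` by the wedge facts, hence in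
  `ι(M)` by the cover clause);
* `dσf v = P01 (dθH (d lamV (dι v))) + P23 (dθV (d lamH (dι v)))` (chain rule);
* the `V`-label differential `dθH ∘ d lamV` takes values in the axis plane `{q₂ = q₃ = 0}` at points
  off `V∞` (there `θH ∘ lamV` has identically vanishing `z₂`-coordinate), same for the `H`-label;
* `dθH`, `dθV` are injective on the chart images, `dι` is injective; with the transversality of
  the two foliations, `dσf` is injective, hence (dimension `4 = 4`) invertible;
* by the inverse function theorem `σf` is a local diffeomorphism, and being bijective it is a
  diffeomorphism `σ : M ≃ₘ ℝ⁴` (`IsLocalDiffeomorph.diffeomorphOfBijective`).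
-/

noncomputable section

-- the registered namespace `Summit.SmoothPoincare4.SmoothPoincare4.Theorems…` repeats a component
set_option linter.dupNamespace false

open scoped Manifold ContDiff Topology
open Set Function Filter Literature.Geometry.Symplectic

namespace Summit.SmoothPoincare4.SmoothPoincare4.Theorems.GromovRecognitionRelEnd.CrossCapLaurent

namespace ReadSigma

open CapModel

/-- Model space `ℝ⁴ = ℂ²` (coordinates `0,1` = `z₁`, `2,3` = `z₂`). -/
local notation "E4" => EuclideanSpace ℝ (Fin 4)

/-! ## Two algebraic facts on `ℝ⁴` -/

/-- `ω₀ (P01 A + P23 B, P01 A' + P23 B') = (A₀A'₁ - A₁A'₀) + (B₂B'₃ - B₃B'₂)`. [folklore] -/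
theorem stdSymplecticForm_P01_P23 (A B A' B' : E4) :
    stdSymplecticForm (P01 A + P23 B) (P01 A' + P23 B') =
      (A 0 * A' 1 - A 1 * A' 0) + (B 2 * B' 3 - B 3 * B' 2) := by
  simp [stdSymplecticForm, P01_apply, P23_apply]; ring

/-- A nonzero vector of the plane `{q₂ = q₃ = 0}` has `q₀² + q₁² > 0`. [folklore] -/
theorem sq01_pos {A : E4} (hA : A ≠ 0) (h23 : P23 A = 0) : 0 < A 0 ^ 2 + A 1 ^ 2 := by
  rw [P23_eq_zero_iff] at h23
  by_contra hle
  have hle' := not_lt.1 hle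
  have h0 : A 0 = 0 := by nlinarith [sq_nonneg (A 0), sq_nonneg (A 1)]
  have h1 : A 1 = 0 := by nlinarith [sq_nonneg (A 0), sq_nonneg (A 1)]
  exact hA (eq_zero_of_P01_P23 ((P01_eq_zero_iff A).2 ⟨h0, h1⟩) ((P23_eq_zero_iff A).2 h23))

/-- A nonzero vector of the plane `{q₀ = q₁ = 0}` has `q₂² + q₃² > 0`. [folklore] -/
theorem sq23_pos {A : E4} (hA : A ≠ 0) (h01 : P01 A = 0) : 0 < A 2 ^ 2 + A 3 ^ 2 := by
  rw [P01_eq_zero_iff] at h01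
  by_contra hle
  have hle' := not_lt.1 hle
  have h2 : A 2 = 0 := by nlinarith [sq_nonneg (A 2), sq_nonneg (A 3)]
  have h3 : A 3 = 0 := by nlinarith [sq_nonneg (A 2), sq_nonneg (A 3)]
  exact hA (eq_zero_of_P01_P23 ((P01_eq_zero_iff A).2 h01) ((P23_eq_zero_iff A).2 ⟨h2, h3⟩))

/-! ## A smooth map to `ℝ⁴` with injective differentials is a local diffeomorphism -/

/-- **Inverse function theorem, injective form**: a `C^∞` map `f : M⁴ → ℝ⁴` whose differential
is injective at every point is a local diffeomorphism (an injective endomorphism of `ℝ⁴` is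
invertible). [cite: LeeSmoothManifolds2013, Thm. 4.5] -/
theorem isLocalDiffeomorph_of_mfderiv_injective {M : Type*} [TopologicalSpace M]
    [ChartedSpace E4 M] [IsManifold (𝓡 4) ∞ M] {f : M → E4}
    (hf : ContMDiff (𝓡 4) 𝓘(ℝ, E4) ∞ f)
    (hinj : ∀ x : M, Injective (mfderiv (𝓡 4) 𝓘(ℝ, E4) f x)) :
    IsLocalDiffeomorph (𝓡 4) 𝓘(ℝ, E4) ∞ f := by
  intro x
  set L : E4 →L[ℝ] E4 := mfderiv (𝓡 4) 𝓘(ℝ, E4) f x with hL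
  let e : E4 ≃ₗ[ℝ] E4 := LinearMap.linearEquivOfInjective (L : E4 →ₗ[ℝ] E4) (hinj x) rfl
  let e' : E4 ≃L[ℝ] E4 := e.toContinuousLinearEquiv
  have he' : mfderiv (𝓡 4) 𝓘(ℝ, E4) f x = (e' : E4 →L[ℝ] E4) := by
    ext v; rfl
  exact Literature.Geometry.Manifold.isLocalDiffeomorphAt_of_mfderiv (by simp) isOpen_univ
    (mem_univ x) hf.contMDiffOn e' he'

variable {M X : Type*} [TopologicalSpace M] [ChartedSpace E4 M] [IsManifold (𝓡 4) ∞ M]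
  [TopologicalSpace X] [ChartedSpace E4 X] [IsManifold (𝓡 4) ∞ X]
  {J : AlmostComplexStructure (𝓡 4) ∞ M} {JX : AlmostComplexStructure (𝓡 4) ∞ X}
  {ι : M → X} {ηH ηV ηC : E4 → X} {χ : E4 → M} {R₁ : ℝ} {lamV lamH : X → X}

/-- **The `V`-label differential** `dθH_{lamV y} (d lamV_y w) ∈ ℝ⁴`. [folklore] -/
def dlabV (ηH : E4 → X) (R₁ : ℝ) (lamV : X → X) (y : X) (w : TangentSpace (𝓡 4) y) : E4 :=
  mfderiv (𝓡 4) 𝓘(ℝ, E4) (θH ηH R₁) (lamV y) (mfderiv (𝓡 4) (𝓡 4) lamV y w)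

/-- **The `H`-label differential** `dθV_{lamH y} (d lamH_y w) ∈ ℝ⁴`. [folklore] -/
def dlabH (ηV : E4 → X) (R₁ : ℝ) (lamH : X → X) (y : X) (w : TangentSpace (𝓡 4) y) : E4 :=
  mfderiv (𝓡 4) 𝓘(ℝ, E4) (θV ηV R₁) (lamH y) (mfderiv (𝓡 4) (𝓡 4) lamH y w)

namespace SigmaHyp

variable (h : SigmaHyp J JX ι ηH ηV ηC χ R₁ lamV lamH)
include h

/-! ## `σf` is a bijection -/

/-- **`σf` is injective** (joint injectivity of the labels, injectivity of `ι`). [folklore] -/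
theorem σf_injective : Injective (σf ι ηH ηV R₁ lamV lamH) := by
  intro x x' hxx
  obtain ⟨a0, a1, a2, a3⟩ := σf_apply ι ηH ηV R₁ lamV lamH x
  obtain ⟨b0, b1, b2, b3⟩ := σf_apply ι ηH ηV R₁ lamV lamH x'
  obtain ⟨pV2, pV3, -, pVη⟩ := h.θH_lamV (h.lamV_ι_ne x)
  obtain ⟨qV2, qV3, -, qVη⟩ := h.θH_lamV (h.lamV_ι_ne x')
  obtain ⟨pH0, pH1, -, pHη⟩ := h.θV_lamH (h.lamH_ι_ne x)
  obtain ⟨qH0, qH1, -, qHη⟩ := h.θV_lamH (h.lamH_ι_ne x')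
  have hV : θH ηH R₁ (lamV (ι x)) = θH ηH R₁ (lamV (ι x')) := by
    ext i; fin_cases i
    · show θH ηH R₁ (lamV (ι x)) 0 = θH ηH R₁ (lamV (ι x')) 0
      rw [← a0, ← b0, hxx]
    · show θH ηH R₁ (lamV (ι x)) 1 = θH ηH R₁ (lamV (ι x')) 1
      rw [← a1, ← b1, hxx]
    · show θH ηH R₁ (lamV (ι x)) 2 = θH ηH R₁ (lamV (ι x')) 2
      rw [pV2, qV2]
    · show θH ηH R₁ (lamV (ι x)) 3 = θH ηH R₁ (lamV (ι x')) 3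
      rw [pV3, qV3]
  have hH : θV ηV R₁ (lamH (ι x)) = θV ηV R₁ (lamH (ι x')) := by
    ext i; fin_cases i
    · show θV ηV R₁ (lamH (ι x)) 0 = θV ηV R₁ (lamH (ι x')) 0
      rw [pH0, qH0]
    · show θV ηV R₁ (lamH (ι x)) 1 = θV ηV R₁ (lamH (ι x')) 1
      rw [pH1, qH1]
    · show θV ηV R₁ (lamH (ι x)) 2 = θV ηV R₁ (lamH (ι x')) 2
      rw [← a2, ← b2, hxx]
    · show θV ηV R₁ (lamH (ι x)) 3 = θV ηV R₁ (lamH (ι x')) 3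
      rw [← a3, ← b3, hxx]
  have h1 : lamV (ι x) = lamV (ι x') := by rw [← pVη, ← qVη, hV]
  have h2 : lamH (ι x) = lamH (ι x') := by rw [← pHη, ← qHη, hH]
  exact h.ι_inj (h.inj _ _ h1 h2)

/-- **`σf` is surjective** (joint surjectivity of the affine labels; the preimage is off
`V∞ ∪ H∞` by the wedge facts, hence in `ι(M)`). [folklore] -/
theorem σf_surjective : Surjective (σf ι ηH ηV R₁ lamV lamH) := by
  intro c
  set p : E4 := WithLp.toLp 2 ![c 0, c 1, 0, 0] with hp
  set q : E4 := WithLp.toLp 2 ![0, 0, c 2, c 3] with hq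
  have hp2 : p 2 = 0 := by simp [hp]
  have hp3 : p 3 = 0 := by simp [hp]
  have hq0 : q 0 = 0 := by simp [hq]
  have hq1 : q 1 = 0 := by simp [hq]
  obtain ⟨y, hyV, hyH⟩ := h.surj p q hp2 hp3 hq0 hq1
  have hV : lamV y ≠ ηC 0 := by rw [hyV]; exact h.wedge_H p hp2 hp3
  have hH : lamH y ≠ ηC 0 := by rw [hyH]; exact h.wedge_V q hq0 hq1
  obtain ⟨x, rfl⟩ := h.mem_range_of_ne hV hH
  refine ⟨x, ?_⟩
  obtain ⟨a0, a1, a2, a3⟩ := σf_apply ι ηH ηV R₁ lamV lamH x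
  rw [hyV, h.θH_ηH (h.mem_DH_of_axis hp2 hp3)] at a0 a1
  rw [hyH, h.θV_ηV (h.mem_DV_of_axis hq0 hq1)] at a2 a3
  ext i; fin_cases i
  · simpa [hp] using a0
  · simpa [hp] using a1
  · simpa [hq] using a2
  · simpa [hq] using a3

/-- **`σf` is a bijection.** [folklore] -/
theorem σf_bijective : Bijective (σf ι ηH ηV R₁ lamV lamH) := ⟨h.σf_injective, h.σf_surjective⟩

/-! ## Differentiability of the pieces -/

/-- `lamV` is differentiable. [folklore] -/
theorem mdiff_lamV (y : X) : MDifferentiableAt (𝓡 4) (𝓡 4) lamV y :=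
  (h.lamV_smooth y).mdifferentiableAt (by simp)

/-- `lamH` is differentiable. [folklore] -/
theorem mdiff_lamH (y : X) : MDifferentiableAt (𝓡 4) (𝓡 4) lamH y :=
  (h.lamH_smooth y).mdifferentiableAt (by simp)

/-- `ι` is differentiable. [folklore] -/
theorem mdiff_ι (x : M) : MDifferentiableAt (𝓡 4) (𝓡 4) ι x :=
  (h.ι_locDiff x).mdifferentiableAt (by simp)

/-- `θH` is differentiable at `lamV y` for `y` off `V∞`. [folklore] -/
theorem mdiff_θH {y : X} (hV : lamV y ≠ ηC 0) :
    MDifferentiableAt (𝓡 4) 𝓘(ℝ, E4) (θH ηH R₁) (lamV y) := by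
  obtain ⟨p, h2, h3, hp⟩ := h.labelV hV
  rw [← hp]
  exact (h.contMDiffAt_θH (h.mem_DH_of_axis h2 h3)).mdifferentiableAt (by simp)

/-- `θV` is differentiable at `lamH y` for `y` off `H∞`. [folklore] -/
theorem mdiff_θV {y : X} (hH : lamH y ≠ ηC 0) :
    MDifferentiableAt (𝓡 4) 𝓘(ℝ, E4) (θV ηV R₁) (lamH y) := by
  obtain ⟨q, h0, h1, hq⟩ := h.labelH hH
  rw [← hq]
  exact (h.contMDiffAt_θV (h.mem_DV_of_axis h0 h1)).mdifferentiableAt (by simp)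

/-- Chain rule for the `V`-label `P01 ∘ θH ∘ lamV`. [folklore] -/
theorem hasMFDerivAt_labV {y : X} (hV : lamV y ≠ ηC 0) :
    HasMFDerivAt (𝓡 4) 𝓘(ℝ, E4) (fun y' => P01 (θH ηH R₁ (lamV y'))) y
      (P01.comp ((mfderiv (𝓡 4) 𝓘(ℝ, E4) (θH ηH R₁) (lamV y)).comp
        (mfderiv (𝓡 4) (𝓡 4) lamV y))) :=
  P01.hasMFDerivAt.comp y ((h.mdiff_θH hV).hasMFDerivAt.comp y (h.mdiff_lamV y).hasMFDerivAt)

/-- Chain rule for the `H`-label `P23 ∘ θV ∘ lamH`. [folklore] -/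
theorem hasMFDerivAt_labH {y : X} (hH : lamH y ≠ ηC 0) :
    HasMFDerivAt (𝓡 4) 𝓘(ℝ, E4) (fun y' => P23 (θV ηV R₁ (lamH y'))) y
      (P23.comp ((mfderiv (𝓡 4) 𝓘(ℝ, E4) (θV ηV R₁) (lamH y)).comp
        (mfderiv (𝓡 4) (𝓡 4) lamH y))) :=
  P23.hasMFDerivAt.comp y ((h.mdiff_θV hH).hasMFDerivAt.comp y (h.mdiff_lamH y).hasMFDerivAt)

/-- **The differential of `Φ`** off `V∞ ∪ H∞`. [folklore] -/
theorem hasMFDerivAt_Φ {y : X} (hV : lamV y ≠ ηC 0) (hH : lamH y ≠ ηC 0) :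
    HasMFDerivAt (𝓡 4) 𝓘(ℝ, E4) (Φ ηH ηV R₁ lamV lamH) y
      (P01.comp ((mfderiv (𝓡 4) 𝓘(ℝ, E4) (θH ηH R₁) (lamV y)).comp
          (mfderiv (𝓡 4) (𝓡 4) lamV y)) +
        P23.comp ((mfderiv (𝓡 4) 𝓘(ℝ, E4) (θV ηV R₁) (lamH y)).comp
          (mfderiv (𝓡 4) (𝓡 4) lamH y))) :=
  (h.hasMFDerivAt_labV hV).add (h.hasMFDerivAt_labH hH)

/-- **The differential of `σf`**: `dσf v = P01 (dθH (d lamV (dι v))) + P23 (dθV (d lamH (dι v)))`.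
[folklore] -/
theorem mfderiv_σf_apply (x : M) (v : TangentSpace (𝓡 4) x) :
    mfderiv (𝓡 4) 𝓘(ℝ, E4) (σf ι ηH ηV R₁ lamV lamH) x v =
      P01 (dlabV ηH R₁ lamV (ι x) (mfderiv (𝓡 4) (𝓡 4) ι x v)) +
        P23 (dlabH ηV R₁ lamH (ι x) (mfderiv (𝓡 4) (𝓡 4) ι x v)) := by
  have hd := ((h.hasMFDerivAt_Φ (h.lamV_ι_ne x) (h.lamH_ι_ne x)).comp x
    (h.mdiff_ι x).hasMFDerivAt).mfderiv
  rw [show σf ι ηH ηV R₁ lamV lamH = Φ ηH ηV R₁ lamV lamH ∘ ι from rfl, hd]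
  rfl

/-! ## The label differentials take values in the axis planes -/

/-- Near a point off `V∞`, the `z₂`-coordinate of `θH ∘ lamV` vanishes identically. [folklore] -/
theorem eventually_P23_θH_lamV [T2Space X] {y : X} (hV : lamV y ≠ ηC 0) :
    (fun y' => P23 (θH ηH R₁ (lamV y'))) =ᶠ[𝓝 y] fun _ => (0 : E4) := by
  have hopen : IsOpen (lamV ⁻¹' {ηC 0}ᶜ) :=
    isOpen_compl_singleton.preimage h.lamV_smooth.continuous
  filter_upwards [hopen.mem_nhds hV] with y' hy'
  have hy'' : lamV y' ≠ ηC 0 := hy'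
  obtain ⟨h2, h3, -, -⟩ := h.θH_lamV hy''
  exact (P23_eq_zero_iff _).2 ⟨h2, h3⟩

/-- Near a point off `H∞`, the `z₁`-coordinate of `θV ∘ lamH` vanishes identically. [folklore] -/
theorem eventually_P01_θV_lamH [T2Space X] {y : X} (hH : lamH y ≠ ηC 0) :
    (fun y' => P01 (θV ηV R₁ (lamH y'))) =ᶠ[𝓝 y] fun _ => (0 : E4) := by
  have hopen : IsOpen (lamH ⁻¹' {ηC 0}ᶜ) :=
    isOpen_compl_singleton.preimage h.lamH_smooth.continuous
  filter_upwards [hopen.mem_nhds hH] with y' hy'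
  have hy'' : lamH y' ≠ ηC 0 := hy'
  obtain ⟨h0, h1, -, -⟩ := h.θV_lamH hy''
  exact (P01_eq_zero_iff _).2 ⟨h0, h1⟩

/-- **`dθH (d lamV w)` lies in the axis plane `{q₂ = q₃ = 0}`** at a point off `V∞`. [folklore] -/
theorem P23_dlabV [T2Space X] {y : X} (hV : lamV y ≠ ηC 0) (w : TangentSpace (𝓡 4) y) :
    P23 (dlabV ηH R₁ lamV y w) = 0 := by
  have h1 : HasMFDerivAt (𝓡 4) 𝓘(ℝ, E4) (fun y' => P23 (θH ηH R₁ (lamV y'))) y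
      (P23.comp ((mfderiv (𝓡 4) 𝓘(ℝ, E4) (θH ηH R₁) (lamV y)).comp
        (mfderiv (𝓡 4) (𝓡 4) lamV y))) :=
    P23.hasMFDerivAt.comp y ((h.mdiff_θH hV).hasMFDerivAt.comp y (h.mdiff_lamV y).hasMFDerivAt)
  have h2 : HasMFDerivAt (𝓡 4) 𝓘(ℝ, E4) (fun y' => P23 (θH ηH R₁ (lamV y'))) y
      (0 : TangentSpace (𝓡 4) y →L[ℝ] E4) :=
    (hasMFDerivAt_const (0 : E4) y).congr_of_eventuallyEq (h.eventually_P23_θH_lamV hV)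
  have h12 := h1.mfderiv.symm.trans h2.mfderiv
  exact congrArg (fun L : TangentSpace (𝓡 4) y →L[ℝ] E4 => L w) h12

/-- **`dθV (d lamH w)` lies in the axis plane `{q₀ = q₁ = 0}`** at a point off `H∞`. [folklore] -/
theorem P01_dlabH [T2Space X] {y : X} (hH : lamH y ≠ ηC 0) (w : TangentSpace (𝓡 4) y) :
    P01 (dlabH ηV R₁ lamH y w) = 0 := by
  have h1 : HasMFDerivAt (𝓡 4) 𝓘(ℝ, E4) (fun y' => P01 (θV ηV R₁ (lamH y'))) y
      (P01.comp ((mfderiv (𝓡 4) 𝓘(ℝ, E4) (θV ηV R₁) (lamH y)).comp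
        (mfderiv (𝓡 4) (𝓡 4) lamH y))) :=
    P01.hasMFDerivAt.comp y ((h.mdiff_θV hH).hasMFDerivAt.comp y (h.mdiff_lamH y).hasMFDerivAt)
  have h2 : HasMFDerivAt (𝓡 4) 𝓘(ℝ, E4) (fun y' => P01 (θV ηV R₁ (lamH y'))) y
      (0 : TangentSpace (𝓡 4) y →L[ℝ] E4) :=
    (hasMFDerivAt_const (0 : E4) y).congr_of_eventuallyEq (h.eventually_P01_θV_lamH hH)
  have h12 := h1.mfderiv.symm.trans h2.mfderiv
  exact congrArg (fun L : TangentSpace (𝓡 4) y →L[ℝ] E4 => L w) h12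

/-! ## Injectivity of the label differentials and of `dσf` -/

/-- **`dθH` is injective at the points `lamV y`, `y` off `V∞`.** [folklore] -/
theorem dθH_eq_zero {y : X} (hV : lamV y ≠ ηC 0) :
    ∀ ξ : TangentSpace (𝓡 4) (lamV y),
      mfderiv (𝓡 4) 𝓘(ℝ, E4) (θH ηH R₁) (lamV y) ξ = 0 → ξ = 0 := by
  obtain ⟨p, h2, h3, hp⟩ := h.labelV hV
  rw [← hp]
  intro ξ hξ
  exact mfderiv_invFunOn_eq_zero h.ηH_locDiff (isOpen_DH R₁) h.ηH_inj (by simp)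
    (h.mem_DH_of_axis h2 h3) hξ

/-- **`dθV` is injective at the points `lamH y`, `y` off `H∞`.** [folklore] -/
theorem dθV_eq_zero {y : X} (hH : lamH y ≠ ηC 0) :
    ∀ ξ : TangentSpace (𝓡 4) (lamH y),
      mfderiv (𝓡 4) 𝓘(ℝ, E4) (θV ηV R₁) (lamH y) ξ = 0 → ξ = 0 := by
  obtain ⟨q, h0, h1, hq⟩ := h.labelH hH
  rw [← hq]
  intro ξ hξ
  exact mfderiv_invFunOn_eq_zero h.ηV_locDiff (isOpen_DV R₁) h.ηV_inj (by simp)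
    (h.mem_DV_of_axis h0 h1) hξ

/-- `dι` is injective. [folklore] -/
theorem dι_eq_zero (x : M) {v : TangentSpace (𝓡 4) x} (hv : mfderiv (𝓡 4) (𝓡 4) ι x v = 0) :
    v = 0 :=
  ((h.ι_locDiff x).mfderivToContinuousLinearEquiv (by simp : (∞ : WithTop ℕ∞) ≠ 0)).map_eq_zero_iff.1
    hv

/-- **If the `z₁`-part of the `V`-label differential vanishes then `d lamV` vanishes** (at a point
off `V∞`): `P01 (dθH (d lamV w)) = 0 → d lamV w = 0`. [folklore] -/
theorem dlamV_eq_zero [T2Space X] {y : X} (hV : lamV y ≠ ηC 0) (w : TangentSpace (𝓡 4) y)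
    (h01 : P01 (dlabV ηH R₁ lamV y w) = 0) : mfderiv (𝓡 4) (𝓡 4) lamV y w = 0 :=
  h.dθH_eq_zero hV _ (eq_zero_of_P01_P23 h01 (h.P23_dlabV hV w))

/-- **If the `z₂`-part of the `H`-label differential vanishes then `d lamH` vanishes** (at a point
off `H∞`). [folklore] -/
theorem dlamH_eq_zero [T2Space X] {y : X} (hH : lamH y ≠ ηC 0) (w : TangentSpace (𝓡 4) y)
    (h23 : P23 (dlabH ηV R₁ lamH y w) = 0) : mfderiv (𝓡 4) (𝓡 4) lamH y w = 0 :=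
  h.dθV_eq_zero hH _ (eq_zero_of_P01_P23 (h.P01_dlabH hH w) h23)

/-- **`dσf` is injective.** [folklore] -/
theorem dσf_eq_zero [T2Space X] (x : M) (v : TangentSpace (𝓡 4) x)
    (hv : mfderiv (𝓡 4) 𝓘(ℝ, E4) (σf ι ηH ηV R₁ lamV lamH) x v = 0) : v = 0 := by
  set u := mfderiv (𝓡 4) (𝓡 4) ι x v with hu
  set A : E4 := dlabV ηH R₁ lamV (ι x) u
  set B : E4 := dlabH ηV R₁ lamH (ι x) u
  rw [h.mfderiv_σf_apply x v] at hv
  obtain ⟨c0, c1, c2, c3⟩ := P01_add_P23_apply A B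
  have hv' : P01 A + P23 B = (0 : E4) := hv
  rw [hv'] at c0 c1 c2 c3
  have hA0 : A 0 = 0 := by rw [← c0]; simp
  have hA1 : A 1 = 0 := by rw [← c1]; simp
  have hB2 : B 2 = 0 := by rw [← c2]; simp
  have hB3 : B 3 = 0 := by rw [← c3]; simp
  have hV := h.dlamV_eq_zero (h.lamV_ι_ne x) u ((P01_eq_zero_iff A).2 ⟨hA0, hA1⟩)
  have hH := h.dlamH_eq_zero (h.lamH_ι_ne x) u ((P23_eq_zero_iff B).2 ⟨hB2, hB3⟩)
  exact h.dι_eq_zero x (h.trans _ u hV hH)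

/-- **`dσf` is injective** (as a map). [folklore] -/
theorem dσf_injective [T2Space X] (x : M) :
    Injective (mfderiv (𝓡 4) 𝓘(ℝ, E4) (σf ι ηH ηV R₁ lamV lamH) x) :=
  (injective_iff_map_eq_zero _).2 (h.dσf_eq_zero x)

/-! ## `σ` is a diffeomorphism -/

/-- **`σf` is a local diffeomorphism** (inverse function theorem: `dσf` is injective, hence
invertible as `dim M = 4 = dim ℝ⁴`). [cite: LeeSmoothManifolds2013, Thm. 4.5] -/
theorem isLocalDiffeomorph_σf [T2Space X] :
    IsLocalDiffeomorph (𝓡 4) 𝓘(ℝ, E4) ∞ (σf ι ηH ηV R₁ lamV lamH) :=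
  isLocalDiffeomorph_of_mfderiv_injective h.contMDiff_σf h.dσf_injective

/-- **The chart `σ : M ≃ₘ ℝ⁴` of the stub** (a bijective local diffeomorphism is a diffeomorphism).
[cite: Gromov1985, §0.3.C] -/
def σ [T2Space X] : M ≃ₘ⟮𝓡 4, 𝓡 4⟯ E4 :=
  IsLocalDiffeomorph.diffeomorphOfBijective h.isLocalDiffeomorph_σf h.σf_bijective

/-- `σ` is `σf` as a function. [folklore] -/
theorem σ_coe [T2Space X] : ⇑(h.σ) = σf ι ηH ηV R₁ lamV lamH := rfl

/-- `σ x = σf x`. [folklore] -/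
theorem σ_apply [T2Space X] (x : M) : h.σ x = σf ι ηH ηV R₁ lamV lamH x := rfl

end SigmaHyp

end ReadSigma

/-- **Registered helper sub-goal `helper_readSigmaInjDiffLocalDiffeo`** (third auxiliary file of
stub `stub_readSigma`): a `C^∞` map from a `4`-manifold to `ℝ⁴` whose differential has trivial
kernel at every point is a `C^∞` local diffeomorphism. [cite: LeeSmoothManifolds2013, Thm. 4.5] -/
theorem helper_readSigmaInjDiffLocalDiffeo : ∀ (M : Type) [TopologicalSpace M]
    [ChartedSpace (EuclideanSpace ℝ (Fin 4)) M] [IsManifold (𝓡 4) ∞ M]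
    (f : M → EuclideanSpace ℝ (Fin 4)), ContMDiff (𝓡 4) (𝓡 4) ∞ f →
    (∀ (x : M) (v : TangentSpace (𝓡 4) x), mfderiv (𝓡 4) (𝓡 4) f x v = 0 → v = 0) →
    IsLocalDiffeomorph (𝓡 4) (𝓡 4) ∞ f :=
  fun _ _ _ _ _ hf hk =>
    ReadSigma.isLocalDiffeomorph_of_mfderiv_injective hf
      fun x => (injective_iff_map_eq_zero _).2 (hk x)

end Summit.SmoothPoincare4.SmoothPoincare4.Theorems.GromovRecognitionRelEnd.CrossCapLaurent

end
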